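import Mathlib
import Literature.MathematicalPhysics.QuantumFieldTheory.PottsHiggsCellularRepresentationFKG
import Literature.MathematicalPhysics.QuantumFieldTheory.PlaquetteRandomClusterDualityThree
import HarnessLib

/-!
# The cellular representation of the Potts lattice Higgs model, III: Theorem 15 (duality of the
# coupled plaquette percolation) on `𝕋³_L`, `i = 1` — the self-duality of the three-dimensional
# `ℤ_q` gauge–Higgs CPP — PROVED

Source: P. Eldridge, M. P. Forsström, B. Schweinhart, *A Cellular Representation of the Potts
Lattice Higgs Model*, arXiv:2602.22199 (2026) [cite: EldridgeForsstromSchweinhart2026] (= EFS26):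
§1.2 Definition 14 (the bullet dual `X• = {x' : x ∉ X}`), **Theorem 15** (duality
`ρ_{p₂,p₁,q,i,𝕋}(P₂,P₁) = ρ_{p₂•,p₁•,q,d-i-1,𝕋•}(P₁•,P₂•)`, `q` prime,
`p₂• = q(1-p₁)/(p₁+q(1-p₁))`, `p₁• = q(1-p₂)/(p₂+q(1-p₂))`), §4.4 Proposition 25
(`H^j(P₁•,P₂•) ≅ H_{d-j}(P₂,P₁)`), Lemma 26 (`b_{i+1}(P₂,P₁) = b_i(P₂,P₁) + |P₂| + |P₁| - |𝕋^{(i)}|`)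
and the proof of Theorem 15 (pp. 16–17: `k₂' = q/k₁`, `k₁' = q/k₂`).

This file continues `PottsHiggsCellularRepresentation.lean` (EFS26 Defs. 1–6, Thms. 5 and 7) and
`PottsHiggsCellularRepresentationFKG.lean` (Lemma 21, Thm. 11, Props. 27–29) in the same
torus-cochain vocabulary (`PlaquetteRC`: sites `Site d L = Fin d → ZMod L`, edges `Site × Fin d`,
plaquettes `Plaquette d L`, `td₁`/`res` = the coboundary, `bd₂` = the boundary of `2`-chains,
`relFlatCochains F F ω = Z¹(P₂,P₁;F)`, `relBettiOne`, `cppWeight`/`cppProb`/`cppEventProb`), for the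
SELF-DUAL case `d = 3`, `i = 1 = d - i - 1`: the coupled plaquette percolation (CPP) of the
three-dimensional `ℤ_q` lattice gauge–Higgs (clock/Potts Higgs) model on the torus `𝕋³_L` is mapped
to itself. Everything below is a `theorem`; the file introduces NO named fact.

HONEST SCOPE. This is a finite-volume identity between two explicit Gibbs-type probability vectors
on the finite set `CppConfig 3 L` (pairs (open plaquettes, open edges) of `𝕋³_L`); it says nothing
about infinite volume, phase transitions, or continuum limits. Nothing in this file (or in this
Literature cluster) proves or approaches the Clay Yang–Mills mass-gap problem; in this tree the route
R4 closes only the conditional finite-`𝕋⁴` rung `BalabanLadder.UV`.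

## What is proved (all `d`, any field `F`, unless marked `𝕋³`)

* `relTwoCycles F ω = Z₂(P₂,P₁;F)`: `2`-chains supported on `P₂ = ω.1` with boundary supported on
  `P₁ = ω.2` (`= H₂(P₂,P₁;F)`, there being no `3`-cells); `finrank_relTwoCycles_add`:
  **`dim Z₂(P₂,P₁) + |X¹| = b₁(P₂,P₁) + |P₂| + |P₁|`** — Lemma 26 for `i = 1`, proved by rank–nullity
  for the relative coboundary `relCoboundaryOn` (`C¹(X,P₁) → C²(P₂)`) and the annihilator count
  `Subspace.finrank_add_finrank_dualAnnihilator_eq` (the relative `2`-cycles are the annihilator of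
  its range under the dot-product pairing, `relTwoCyclesEquiv`), exactly as in
  `PlaquetteRandomClusterDuality.lean` for the absolute case.
* `bd₂_apply`: the boundary of a `2`-chain at an edge, explicitly.
* (`𝕋³`) `CppDual3.dualEdge₃ : Plaquette 3 L → Site 3 L × Fin 3` (plaquette `(z; a<b)` ↦ the dual
  edge `((z - e_c)•, c)`, `c` the normal direction, dual sites `x• = x + (½,½,½)` labelled by `x`),
  `CppDual3.dualPlaq₃` (edge `(x,k)` ↦ the dual plaquette `((x - e_i - e_j)•; i<j)`, `{i,j,k} =
  {0,1,2}`), both bijections (`dualEdgeEquiv₃`, `dualPlaqEquiv₃`; `card_plaquette_eq_card_edge`: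
  `|X²| = |X¹|`), and **Definition 14**: `dualConfig₃ ω = (P₁•, P₂•) = (dualPlaq₃ '' P₁ᶜ, dualEdge₃ '' P₂ᶜ)`,
  a bijection of `CppConfig 3 L` (`dualConfig₃_bijective`) with `|P₁•| = |X¹| - |P₁|`,
  `|P₂•| = |X²| - |P₂|`.
* (`𝕋³`) **Proposition 25, concretely** (`j = 1`, `d - j = 2`): the transfer
  `dualCochain₃ c (w, m) = s(π_m) · c(w + e_m; π_m)` (`s = Dual3.faceSign`) is a linear equivalence
  `(Plaquette 3 L → F) ≃ₗ (Site 3 L → Fin 3 → F)` with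
  `res (td₁ (dualCochain₃ c)) (dualPlaq₃ (x,k)) = ± bd₂ c x k` (`res_td₁_dualCochain₃_dualPlaq₃`) and
  `dualCochain₃ c (dualEdge₃ σ) = ± c σ`; hence `dualCochain₃ c ∈ Z¹(P₁•,P₂•) ↔ c ∈ Z₂(P₂,P₁)`
  (`dualCochain₃_mem_relFlatCochains_iff`), `Z¹(P₁•,P₂•;F) = dualCochain₃ '' Z₂(P₂,P₁;F)`
  (`relFlatCochains_dualConfig₃_eq`), `b₁(P₁•,P₂•) = dim Z₂(P₂,P₁)` (`relBettiOne_dualConfig₃`) and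
  **`b₁(ω•) + |X¹| = b₁(ω) + |P₂| + |P₁|`** (`relBettiOne_dualConfig₃_add`). No deformation
  retraction or Alexander duality is imported: on the cubical torus the isomorphism is this explicit
  cell-by-cell transfer.
* (`𝕋³`, `q` prime, `p₂, p₁ ∈ (0,1)`) **Theorem 15**: with the tree's dual parameter
  `PlaquetteRC.dualParam p q = (1-p)q/((1-p)q+p)` (`= p•`; `dualParam_mem_Ioo`,
  `one_sub_dualParam_mul`: `(1-p•)q(1-p) = p• p`, i.e. `k• k = q`):
  `cppWeight_dualConfig₃`: `w_{(p₁)•,(p₂)•}(ω•) · (q(1-p₂)(1-p₁))^{|X¹|} = ((p₁)•(p₂)•)^{|X¹|} · w_{p₂,p₁}(ω)`;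
  `cppPartitionFn_dual₃`: `Z• = C · Z`; **`cppProb_dualConfig₃`:
  `ρ_{(p₁)•,(p₂)•}(ω•) = ρ_{p₂,p₁}(ω)`**; and the event form `cppEventProb_image_dualConfig₃`:
  `ρ_{(p₁)•,(p₂)•}(E•) = ρ_{p₂,p₁}(E)` ("a bijective measure-preserving mapping").

## Transcriber's notes

(T1) Lemma 26 is printed with `|𝕋^{(i+1)}|`; its own proof (the Euler-characteristic count
`(-1)^i(|𝕋^{(i)}| - |P₂| - |P₁|)`) and ours give `|𝕋^{(i)}|`; the two coincide exactly in the
self-dual dimension `d = 2i+1`, in particular on `𝕋³` with `i = 1` (`card_plaquette_eq_card_edge`),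
which is the only case used here and in the printed proof of Theorem 15 for `d = 3`.
(T2) Theorem 15 is printed for `p₂, p₁ ∈ [0,1]`; we state it on the open square, where the
proportionality constant `((p₁)•(p₂)•)^{|X¹|}/(q(1-p₂)(1-p₁))^{|X¹|}` is finite and non-zero (at the
corners one side degenerates to a point mass). TODO(general form): the degenerate boundary cases.
(T3) Definition 14's half-integer shift is modelled combinatorially (dual cells are labelled by
primal cells through `dualEdge₃`/`dualPlaq₃`; incidences carry the cube–face sign `Dual3.faceSign`
of `PlaquetteRandomClusterDualityThree.lean`); only `d = 3` is typed (the general `(d, i)` statement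
needs the `j`-cell calculus for all `j`, which the `PlaquetteRC` vocabulary does not have).
(T4) EFS26's `p•` is literally the plaquette-random-cluster dual parameter `p*` of
Duncan–Schweinhart already in the tree (`PlaquetteRC.dualParam`, [cite: DuncanSchweinhart2025, §4.3]);
it is reused, not re-declared.
-/

open Finset Module

namespace Literature.MathematicalPhysics.QuantumFieldTheory

namespace PlaquetteRC

open LatticeForm

variable {d L : ℕ}

/-! ### Relative `2`-cycles `Z₂(P₂, P₁; F)` and their dimension (Lemma 26 on the torus, `i = 1`) -/

section RelTwoCycles

variable (F : Type*) [Field F] [NeZero L]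

/-- **The relative `2`-cycles `Z₂(P₂, P₁; F) = H₂(P₂, P₁; F)`**: `2`-chains supported on the open
plaquettes `P₂` whose boundary is supported on the open edges `P₁` (no `3`-cells in `P₂`, so
cycles = homology). [cite: EldridgeForsstromSchweinhart2026, §2.2 (relative homology) and §4.4 Prop. 25] -/
def relTwoCycles (ω : CppConfig d L) : Submodule F (Plaquette d L → F) where
  carrier := {c | (∀ σ, σ ∉ ω.1 → c σ = 0) ∧ ∀ e : Site d L × Fin d, e ∉ ω.2 → bd₂ c e.1 e.2 = 0}
  add_mem' := by
    rintro a b ⟨ha, ha0⟩ ⟨hb, hb0⟩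
    refine ⟨fun σ hσ => by rw [Pi.add_apply, ha σ hσ, hb σ hσ, add_zero], fun e he => ?_⟩
    have := (bd₂Lin (d := d) (L := L) F).map_add a b
    simp only [bd₂Lin_apply] at this
    rw [this, Pi.add_apply, Pi.add_apply, ha0 e he, hb0 e he, add_zero]
  zero_mem' := by
    refine ⟨fun _ _ => rfl, fun e _ => ?_⟩
    have := (bd₂Lin (d := d) (L := L) F).map_zero
    simp only [bd₂Lin_apply] at this
    rw [this]; rfl
  smul_mem' := by
    rintro r a ⟨ha, ha0⟩
    refine ⟨fun σ hσ => by rw [Pi.smul_apply, ha σ hσ, smul_zero], fun e he => ?_⟩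
    have := (bd₂Lin (d := d) (L := L) F).map_smul r a
    simp only [bd₂Lin_apply] at this
    rw [this, Pi.smul_apply, Pi.smul_apply, ha0 e he, smul_zero]

/-- Membership in `Z₂(P₂, P₁; F)`. [cite: EldridgeForsstromSchweinhart2026, §2.2] -/
theorem mem_relTwoCycles {ω : CppConfig d L} {c : Plaquette d L → F} :
    c ∈ relTwoCycles F ω ↔
      (∀ σ, σ ∉ ω.1 → c σ = 0) ∧ ∀ e : Site d L × Fin d, e ∉ ω.2 → bd₂ c e.1 e.2 = 0 := Iff.rfl

/-- The relative cochains `C¹(X, P₁; F)` (zero on the open edges) are the functions on the CLOSED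
edges: `C¹(X, P₁; F) ≃ F^{X¹ ∖ P₁}`. [cite: EldridgeForsstromSchweinhart2026, §2.2 (relative cochain groups)] -/
noncomputable def vanishingCochainsEquiv (S : Finset (Site d L × Fin d)) :
    vanishingCochains (d := d) (L := L) F F S ≃ₗ[F] (↥(Sᶜ) → F) := by
  classical
  exact
  { toFun := fun θ e => θ.1 e.1.1 e.1.2
    map_add' := fun a b => by funext e; rfl
    map_smul' := fun r a => by funext e; rfl
    invFun := fun f => ⟨fun x k => if h : (x, k) ∈ Sᶜ then f ⟨(x, k), h⟩ else 0, fun e he => by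
        have : (e.1, e.2) ∉ Sᶜ := by simpa using he
        simp [this]⟩
    left_inv := fun θ => by
      apply Subtype.ext
      funext x k
      by_cases h : (x, k) ∈ Sᶜ
      · simp [h]
      · have hS : (x, k) ∈ S := by simpa using h
        simp [h, θ.2 (x, k) hS]
    right_inv := fun f => by
      funext e
      simp [e.2] }

/-- `dim C¹(X, P₁; F) = |X¹| - |P₁|` (the number of closed edges). [cite: EldridgeForsstromSchweinhart2026, §2.2] -/
theorem finrank_vanishingCochains (S : Finset (Site d L × Fin d)) :
    finrank F (vanishingCochains (d := d) (L := L) F F S) = Sᶜ.card := by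
  rw [(vanishingCochainsEquiv (d := d) (L := L) F S).finrank_eq, Module.finrank_fintype_fun_eq_card,
    Fintype.card_coe]

/-- The relative restricted coboundary `δ_{P₂} : C¹(X, P₁; F) → F^{P₂}` (whose kernel is
`Z¹(P₂, P₁)` and whose transpose is the relative boundary). [cite: EldridgeForsstromSchweinhart2026, §4.3 (proof of Prop. 24: the linear equations defining Z^i(P,Q))] -/
noncomputable def relCoboundaryOn (ω : CppConfig d L) :
    vanishingCochains (d := d) (L := L) F F ω.2 →ₗ[F] (↥ω.1 → F) :=
  coboundaryOn (d := d) (L := L) F ω.1 ∘ₗ (vanishingCochains F F ω.2).subtype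

omit [NeZero L] in
/-- `dim ker δ_{P₂}|_{C¹(X,P₁)} = b₁(P₂, P₁)`. [cite: EldridgeForsstromSchweinhart2026, §2.2 Def. 16] -/
theorem finrank_ker_relCoboundaryOn (ω : CppConfig d L) :
    finrank F (LinearMap.ker (relCoboundaryOn (d := d) (L := L) F ω)) = relBettiOne F ω := by
  unfold relCoboundaryOn relBettiOne relFlatCochains
  rw [LinearMap.ker_comp, ker_coboundaryOn]
  have h : Submodule.comap (vanishingCochains (d := d) (L := L) F F ω.2).subtype (flatCochains F F ω.1) =
      Submodule.comap (vanishingCochains (d := d) (L := L) F F ω.2).subtype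
        (flatCochains F F ω.1 ⊓ vanishingCochains F F ω.2) := by
    rw [Submodule.comap_inf, Submodule.comap_subtype_self, inf_top_eq]
  rw [h]
  exact (Submodule.comapSubtypeEquivOfLe (p := flatCochains F F ω.1 ⊓ vanishingCochains F F ω.2)
    (q := vanishingCochains (d := d) (L := L) F F ω.2) inf_le_right).finrank_eq

/-- **Rank–nullity for the relative coboundary**: `rank δ_{P₂}|_{C¹(X,P₁)} + b₁(P₂,P₁) = |X¹| - |P₁|`.
[cite: EldridgeForsstromSchweinhart2026, §4.4 Lemma 26 (proof: Euler characteristic)] -/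
theorem finrank_range_relCoboundaryOn_add (ω : CppConfig d L) :
    finrank F (LinearMap.range (relCoboundaryOn (d := d) (L := L) F ω)) + relBettiOne F ω = ω.2ᶜ.card := by
  rw [← finrank_ker_relCoboundaryOn F ω, LinearMap.finrank_range_add_finrank_ker,
    finrank_vanishingCochains]

/-- The annihilator of `δ_{P₂}(C¹(X, P₁))` in `F^{P₂}` (dot product).
[cite: EldridgeForsstromSchweinhart2026, §2.4 (Alexander duality: chains vs cochains)] -/
noncomputable def relRangeOrth (ω : CppConfig d L) : Submodule F (↥ω.1 → F) :=
  (LinearMap.range (relCoboundaryOn (d := d) (L := L) F ω)).dualAnnihilator.comap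
    (dotProductEquiv F ↥ω.1).toLinearMap

omit [NeZero L] in
/-- Membership in the relative annihilator. [cite: EldridgeForsstromSchweinhart2026, §2.4] -/
theorem mem_relRangeOrth {ω : CppConfig d L} {c : ↥ω.1 → F} :
    c ∈ relRangeOrth F ω ↔
      ∀ θ : vanishingCochains (d := d) (L := L) F F ω.2, dotProduct c (coboundaryOn F ω.1 θ.1) = 0 := by
  unfold relRangeOrth
  rw [Submodule.mem_comap, Submodule.mem_dualAnnihilator]
  constructor
  · intro h θ
    have := h _ (LinearMap.mem_range_self _ θ)
    simpa [relCoboundaryOn] using this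
  · intro h w hw
    obtain ⟨θ, rfl⟩ := LinearMap.mem_range.mp hw
    simpa [relCoboundaryOn] using h θ

/-- `dim (δ_{P₂} C¹(X,P₁))^⊥ + rank = |P₂|`. [cite: EldridgeForsstromSchweinhart2026, §2.4] -/
theorem finrank_relRangeOrth_add (ω : CppConfig d L) :
    finrank F (relRangeOrth F ω) + finrank F (LinearMap.range (relCoboundaryOn (d := d) (L := L) F ω)) =
      ω.1.card := by
  have h1 := Subspace.finrank_add_finrank_dualAnnihilator_eq
    (LinearMap.range (relCoboundaryOn (d := d) (L := L) F ω))
  have h3 : finrank F (relRangeOrth F ω) =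
      finrank F (LinearMap.range (relCoboundaryOn (d := d) (L := L) F ω)).dualAnnihilator := by
    unfold relRangeOrth
    exact (Submodule.comap_equiv_eq_map_symm (dotProductEquiv F ↥ω.1)
      (LinearMap.range (relCoboundaryOn (d := d) (L := L) F ω)).dualAnnihilator) ▸
      LinearEquiv.finrank_map_eq _ _
  rw [Module.finrank_fintype_fun_eq_card, Fintype.card_coe] at h1
  omega

/-- For a `2`-chain `c` supported on `P₂`: `∂c` is supported on `P₁` iff `c|_{P₂}` is orthogonal to
`δ_{P₂}(C¹(X,P₁))` (`∂ = δᵀ`, tested against the cochains vanishing on `P₁`, which include the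
indicators of the closed edges). [cite: EldridgeForsstromSchweinhart2026, §4.4 Prop. 25 (relative Alexander duality) — here as linear algebra] -/
theorem bd₂_vanish_iff_restrict_mem {ω : CppConfig d L} {c : Plaquette d L → F}
    (hc : ∀ σ, σ ∉ ω.1 → c σ = 0) :
    (∀ e : Site d L × Fin d, e ∉ ω.2 → bd₂ c e.1 e.2 = 0) ↔
      (fun σ : ↥ω.1 => c σ.1) ∈ relRangeOrth F ω := by
  rw [mem_relRangeOrth]
  have hsum : ∀ θ : Site d L → Fin d → F,
      dotProduct (fun σ : ↥ω.1 => c σ.1) (coboundaryOn F ω.1 θ) = pairing θ (bd₂ c) := by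
    intro θ
    rw [pairing_bd₂]
    unfold dotProduct pairing₂
    simp only [coboundaryOn_apply]
    rw [show (∑ σ : ↥ω.1, c σ.1 * res (td₁ θ) σ.1) = ∑ σ ∈ ω.1, c σ * res (td₁ θ) σ from
      Finset.sum_coe_sort ω.1 (fun σ => c σ * res (td₁ θ) σ)]
    rw [Finset.sum_subset (Finset.subset_univ ω.1)]
    · exact Finset.sum_congr rfl fun σ _ => mul_comm _ _
    · intro σ _ hσ
      rw [hc σ hσ, zero_mul]
  simp_rw [hsum]
  constructor
  · intro h θ
    unfold pairing
    refine Finset.sum_eq_zero fun x _ => Finset.sum_eq_zero fun k _ => ?_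
    by_cases he : (x, k) ∈ ω.2
    · rw [θ.2 (x, k) he, zero_mul]
    · rw [h (x, k) he, mul_zero]
  · intro h e he
    have hmem : edgeInd (R := F) e.1 e.2 ∈ vanishingCochains (d := d) (L := L) F F ω.2 := by
      intro e' he'
      have hne : ¬ (e'.1 = e.1 ∧ e'.2 = e.2) := by
        rintro ⟨h1, h2⟩
        exact he (by rw [show e = e' from Prod.ext h1.symm h2.symm]; exact he')
      simp only [edgeInd, if_neg hne]
    have := h ⟨edgeInd (R := F) e.1 e.2, hmem⟩
    rwa [pairing_edgeInd_left] at this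

/-- `Z₂(P₂, P₁; F) ≃ (δ_{P₂} C¹(X,P₁))^⊥` by restriction to the open plaquettes.
[cite: EldridgeForsstromSchweinhart2026, §4.4 Prop. 25] -/
noncomputable def relTwoCyclesEquiv (ω : CppConfig d L) : relTwoCycles F ω ≃ₗ[F] relRangeOrth F ω := by
  classical
  exact
  { toFun := fun z => ⟨fun σ => z.1 σ.1, (bd₂_vanish_iff_restrict_mem F z.2.1).mp z.2.2⟩
    map_add' := fun a b => by ext σ; rfl
    map_smul' := fun r a => by ext σ; rfl
    invFun := fun c =>
      have hsupp : ∀ σ, σ ∉ ω.1 → (fun τ => if h : τ ∈ ω.1 then c.1 ⟨τ, h⟩ else (0 : F)) σ = 0 :=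
        fun σ hσ => by simp [hσ]
      ⟨fun σ => if h : σ ∈ ω.1 then c.1 ⟨σ, h⟩ else 0, by
        refine ⟨hsupp, ?_⟩
        rw [bd₂_vanish_iff_restrict_mem F hsupp]
        have : (fun σ : ↥ω.1 => (fun τ => if h : τ ∈ ω.1 then c.1 ⟨τ, h⟩ else (0 : F)) σ.1) = c.1 := by
          funext σ; simp [σ.2]
        rw [this]; exact c.2⟩
    left_inv := fun z => by
      apply Subtype.ext
      funext σ
      by_cases h : σ ∈ ω.1
      · simp [h]
      · simp [h, z.2.1 σ h]
    right_inv := fun c => by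
      apply Subtype.ext
      funext σ
      simp [σ.2] }

/-- **Lemma 26 on the torus (`i = 1`), PROVED: `dim Z₂(P₂,P₁) + |X¹| = b₁(P₂,P₁) + |P₂| + |P₁|`**,
i.e. `b₂(P₂,P₁) = b₁(P₂,P₁) + |P₂| + |P₁| - |X¹|` (printed with `|𝕋^{(i+1)}|`; the proof there uses
the `i`-cells: transcriber's reading). Proof here: rank–nullity for the relative restricted
coboundary and `∂ = δᵀ`. [cite: EldridgeForsstromSchweinhart2026, §4.4 Lemma 26] -/
theorem finrank_relTwoCycles_add (ω : CppConfig d L) :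
    finrank F (relTwoCycles F ω) + Fintype.card (Site d L × Fin d) =
      relBettiOne F ω + ω.1.card + ω.2.card := by
  rw [(relTwoCyclesEquiv (d := d) (L := L) F ω).finrank_eq]
  have h1 := finrank_relRangeOrth_add F ω
  have h2 := finrank_range_relCoboundaryOn_add F ω
  have h3 : ω.2ᶜ.card + ω.2.card = Fintype.card (Site d L × Fin d) := by
    rw [add_comm, Finset.card_add_card_compl]
  omega

end RelTwoCycles

/-! ### The boundary of a `2`-chain at an edge, explicitly -/

section BdTwoApply

variable [NeZero L] {R : Type*} [CommRing R]

/-- A point mass against a shifted indicator. [folklore] -/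
private theorem sum_mul_ite_eq_and (f : Site d L → R) (y v : Site d L) (P : Prop) [Decidable P] :
    (∑ z : Site d L, f z * (if z + v = y ∧ P then (1 : R) else 0)) = if P then f (y - v) else 0 := by
  classical
  have h : ∀ z : Site d L, (f z * if z + v = y ∧ P then (1 : R) else 0) =
      if z = y - v then (if P then f z else 0) else 0 := by
    intro z
    by_cases hz : z = y - v
    · subst hz
      by_cases hP : P
      · simp [hP]
      · simp [hP]
    · have : ¬ (z + v = y ∧ P) := fun hh => hz (eq_sub_of_add_eq hh.1)
      rw [if_neg this, if_neg hz, mul_zero]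
  simp_rw [h]
  rw [Finset.sum_ite_eq' Finset.univ (y - v)]
  simp

/-- **`∂` of a `2`-chain at the edge `(x, k)`, explicitly**: the signed sum of its values on the
plaquettes containing the edge,
`(∂c)(x,k) = Σ_{π=(a<b)} ( [a=k] c(x;π) + [b=k] c(x-e_a;π) - [a=k] c(x-e_b;π) - [b=k] c(x;π) )`.
[cite: EldridgeForsstromSchweinhart2026, §2.1 (the boundary map ∂_j)] -/
theorem bd₂_apply (c : Plaquette d L → R) (x : Site d L) (k : Fin d) :
    bd₂ c x k = ∑ π : {p : Fin d × Fin d // p.1 < p.2},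
      ((if π.1.1 = k then c (x, π) else 0) + (if π.1.2 = k then c (x - te π.1.1, π) else 0)
        - (if π.1.1 = k then c (x - te π.1.2, π) else 0) - (if π.1.2 = k then c (x, π) else 0)) := by
  classical
  unfold bd₂
  rw [Fintype.sum_prod_type, Finset.sum_comm]
  refine Finset.sum_congr rfl fun π _ => ?_
  have hexp : ∀ z : Site d L, c (z, π) * res (td₁ (edgeInd (R := R) x k)) (z, π) =
      c (z, π) * (if z + 0 = x ∧ π.1.1 = k then (1 : R) else 0)
      + c (z, π) * (if z + te π.1.1 = x ∧ π.1.2 = k then (1 : R) else 0)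
      - c (z, π) * (if z + te π.1.2 = x ∧ π.1.1 = k then (1 : R) else 0)
      - c (z, π) * (if z + 0 = x ∧ π.1.2 = k then (1 : R) else 0) := by
    intro z
    simp only [res, td₁, edgeInd, add_zero]
    ring
  simp_rw [hexp]
  rw [Finset.sum_sub_distrib, Finset.sum_sub_distrib, Finset.sum_add_distrib,
    sum_mul_ite_eq_and, sum_mul_ite_eq_and, sum_mul_ite_eq_and, sum_mul_ite_eq_and, sub_zero]

end BdTwoApply


/-! ### The dual cells of `𝕋³_L`: plaquette ↦ dual edge, edge ↦ dual plaquette -/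

namespace CppDual3

open Dual3

/-- The plane perpendicular to the direction `m`: `0 ↦ {1,2}`, `1 ↦ {0,2}`, `2 ↦ {0,1}` (inverse of
`Dual3.complDir`). [cite: EldridgeForsstromSchweinhart2026, §1.2 Def. 14 (the dual (d-i)-cell)] -/
def perpPlane : Fin 3 → Plane :=
  ![⟨((1 : Fin 3), (2 : Fin 3)), by decide⟩, ⟨((0 : Fin 3), (2 : Fin 3)), by decide⟩,
    ⟨((0 : Fin 3), (1 : Fin 3)), by decide⟩]

/-- `complDir ∘ perpPlane = id`. [cite: EldridgeForsstromSchweinhart2026, §1.2 Def. 14] -/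
theorem complDir_perpPlane : ∀ m : Fin 3, complDir (perpPlane m).1.1 (perpPlane m).1.2 = m := by decide

/-- `perpPlane ∘ complDir = id`. [cite: EldridgeForsstromSchweinhart2026, §1.2 Def. 14] -/
theorem perpPlane_complDir : ∀ π : Plane, perpPlane (complDir π.1.1 π.1.2) = π := by decide

/-- The sign `t_k` in `δ•(dual plaquette of (x,k)) = t_k ∂(x,k)`: `-1` for the middle direction.
[cite: EldridgeForsstromSchweinhart2026, §4.4 (proof of Thm. 15: orientations of dual cells)] -/
def dualSign (k : Fin 3) : ℤ := if k = 1 then -1 else 1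

/-- `t_k² = 1`. [cite: EldridgeForsstromSchweinhart2026, §4.4] -/
theorem dualSign_mul_self (k : Fin 3) : dualSign k * dualSign k = 1 := by
  unfold dualSign; split_ifs <;> norm_num

variable {L : ℕ}

/-- **The dual edge of a plaquette** `(z; a<b)` of `𝕋³_L`: the positively oriented dual edge from
the dual site `(z - e_c)•` to `z•` in the normal direction `c` (dual sites `x• = x + (½,½,½)`
labelled by `x`). [cite: EldridgeForsstromSchweinhart2026, §1.2 Def. 14 (bullet dual)] -/
def dualEdge₃ (σ : Plaquette 3 L) : Site 3 L × Fin 3 :=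
  (σ.1 - te (complDir σ.2.1.1 σ.2.1.2), complDir σ.2.1.1 σ.2.1.2)

/-- **The dual plaquette of an edge** `(x, k)`: the dual plaquette perpendicular to `e_k` through the
midpoint of the edge, based at the dual site `(x - e_i - e_j)•`, `{i<j} = {0,1,2} ∖ {k}`.
[cite: EldridgeForsstromSchweinhart2026, §1.2 Def. 14 (bullet dual)] -/
def dualPlaq₃ (e : Site 3 L × Fin 3) : Plaquette 3 L :=
  (e.1 - te (perpPlane e.2).1.1 - te (perpPlane e.2).1.2, perpPlane e.2)

/-- `σ ↦ dualEdge₃ σ` is a bijection `X² ≃ X•¹` (inverse `(w, m) ↦ (w + e_m; plane ⊥ m)`).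
[cite: EldridgeForsstromSchweinhart2026, §1.2 Def. 14] -/
def dualEdgeEquiv₃ : Plaquette 3 L ≃ Site 3 L × Fin 3 where
  toFun := dualEdge₃
  invFun e := (e.1 + te e.2, perpPlane e.2)
  left_inv σ := by
    obtain ⟨z, π⟩ := σ
    simp only [dualEdge₃, sub_add_cancel, perpPlane_complDir]
  right_inv e := by
    obtain ⟨w, m⟩ := e
    simp only [dualEdge₃, complDir_perpPlane, add_sub_cancel_right]

/-- `e ↦ dualPlaq₃ e` is a bijection `X¹ ≃ X•²`. [cite: EldridgeForsstromSchweinhart2026, §1.2 Def. 14] -/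
def dualPlaqEquiv₃ : (Site 3 L × Fin 3) ≃ Plaquette 3 L where
  toFun := dualPlaq₃
  invFun σ := (σ.1 + te σ.2.1.1 + te σ.2.1.2, complDir σ.2.1.1 σ.2.1.2)
  left_inv e := by
    obtain ⟨x, k⟩ := e
    simp only [dualPlaq₃, complDir_perpPlane, Prod.mk.injEq, and_true]
    abel
  right_inv σ := by
    obtain ⟨z, π⟩ := σ
    simp only [dualPlaq₃, perpPlane_complDir, Prod.mk.injEq, and_true]
    abel

/-- `dualEdge₃` is injective. [cite: EldridgeForsstromSchweinhart2026, §1.2 Def. 14] -/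
theorem dualEdge₃_injective : Function.Injective (dualEdge₃ (L := L)) := dualEdgeEquiv₃.injective

/-- `dualPlaq₃` is injective. [cite: EldridgeForsstromSchweinhart2026, §1.2 Def. 14] -/
theorem dualPlaq₃_injective : Function.Injective (dualPlaq₃ (L := L)) := dualPlaqEquiv₃.injective

/-- **`|X²| = |X¹|` on `𝕋³_L`** (both `3L³`; here through the bijection `dualEdgeEquiv₃`).
[cite: EldridgeForsstromSchweinhart2026, §4.4 (proof of Thm. 15, d - i - 1 = i)] -/
theorem card_plaquette_eq_card_edge [NeZero L] :
    Fintype.card (Plaquette 3 L) = Fintype.card (Site 3 L × Fin 3) :=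
  Fintype.card_congr dualEdgeEquiv₃

variable {F : Type*} [Field F]

/-- **Transfer of `2`-chains to dual `1`-cochains**: `g(w, m) = s(π_m) c(w + e_m; π_m)` — the value
of the dual edge cochain on the dual edge from `w•` to `(w+e_m)•` is the (signed) value of the
`2`-chain on the primal plaquette it pierces (`s = Dual3.faceSign`, the cube–face incidence sign).
[cite: EldridgeForsstromSchweinhart2026, §4.4 Prop. 25 (H^j(P₁•,P₂•) ≅ H_{d-j}(P₂,P₁))] -/
def dualCochain₃ (c : Plaquette 3 L → F) : Site 3 L → Fin 3 → F :=
  fun w m => (faceSign (perpPlane m) : F) * c (w + te m, perpPlane m)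

/-- The inverse transfer `c(σ) = s(σ) g(dualEdge₃ σ)`. [cite: EldridgeForsstromSchweinhart2026, §4.4 Prop. 25] -/
def primalChain₃ (g : Site 3 L → Fin 3 → F) : Plaquette 3 L → F :=
  fun σ => (faceSign σ.2 : F) * g (dualEdge₃ σ).1 (dualEdge₃ σ).2

/-- `s(π)² = 1` in `F`. [cite: DuncanSchweinhart2025, §2.1] -/
theorem faceSign_cast_mul_self (π : Plane) : ((faceSign π : ℤ) : F) * (faceSign π : F) = 1 := by
  rw [← Int.cast_mul, faceSign_mul_self, Int.cast_one]

/-- The value of the dual cochain on the dual edge of `σ` is `s(σ) c(σ)`. [cite: EldridgeForsstromSchweinhart2026, §4.4 Prop. 25] -/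
theorem dualCochain₃_dualEdge₃ (c : Plaquette 3 L → F) (σ : Plaquette 3 L) :
    dualCochain₃ c (dualEdge₃ σ).1 (dualEdge₃ σ).2 = (faceSign σ.2 : F) * c σ := by
  obtain ⟨z, π⟩ := σ
  simp only [dualCochain₃, dualEdge₃, perpPlane_complDir, sub_add_cancel]

/-- The transfer as a linear equivalence `C₂(𝕋³; F) ≃ C¹(𝕋³•; F)`. [cite: EldridgeForsstromSchweinhart2026, §4.4 Prop. 25] -/
def dualCochainEquiv₃ : (Plaquette 3 L → F) ≃ₗ[F] (Site 3 L → Fin 3 → F) where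
  toFun := dualCochain₃
  map_add' a b := by funext w m; simp only [dualCochain₃, Pi.add_apply, mul_add]
  map_smul' r a := by funext w m; simp only [dualCochain₃, Pi.smul_apply, smul_eq_mul, RingHom.id_apply]; ring
  invFun := primalChain₃
  left_inv c := by
    funext σ
    simp only [primalChain₃, dualCochain₃_dualEdge₃, ← mul_assoc, faceSign_cast_mul_self, one_mul]
  right_inv g := by
    funext w m
    simp only [dualCochain₃, primalChain₃, dualEdge₃, complDir_perpPlane, add_sub_cancel_right,
      ← mul_assoc, faceSign_cast_mul_self, one_mul]

/-- `dualCochainEquiv₃` is `dualCochain₃`. [cite: EldridgeForsstromSchweinhart2026, §4.4] -/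
@[simp] theorem dualCochainEquiv₃_apply (c : Plaquette 3 L → F) :
    dualCochainEquiv₃ (L := L) (F := F) c = dualCochain₃ c := rfl

/-- Site arithmetic. [folklore] -/
private theorem site_sub_sub_add_left (x a b : Site 3 L) : x - a - b + a = x - b := by abel

variable [NeZero L]

/-- Sums over the three planes of `ℤ³`. [folklore] -/
private theorem sum_plane {R : Type*} [AddCommMonoid R] (f : Plane → R) :
    ∑ π : Plane, f π = f (perpPlane 0) + f (perpPlane 1) + f (perpPlane 2) := by
  rw [← Fintype.sum_equiv (Equiv.mk perpPlane (fun π => complDir π.1.1 π.1.2) complDir_perpPlane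
    perpPlane_complDir) (fun m => f (perpPlane m)) f (fun _ => rfl), Fin.sum_univ_three]

/-- **The dual coboundary is the primal boundary**: for every `2`-chain `c` and every edge `(x,k)`,
`(δ• g_c)(dual plaquette of (x,k)) = t_k · (∂c)(x,k)` with `g_c = dualCochain₃ c`, `t_k = ±1` — the
combinatorial content of relative Alexander duality `H^1(P₁•, P₂•) ≅ H_2(P₂, P₁)` on `𝕋³`.
[cite: EldridgeForsstromSchweinhart2026, §4.4 Prop. 25] -/
theorem res_td₁_dualCochain₃_dualPlaq₃ (c : Plaquette 3 L → F) (x : Site 3 L) (k : Fin 3) :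
    res (td₁ (dualCochain₃ c)) (dualPlaq₃ (x, k)) = (dualSign k : F) * bd₂ c x k := by
  rw [bd₂_apply, sum_plane]
  fin_cases k
  all_goals
    simp (config := {decide := true}) [res, td₁, dualCochain₃, dualPlaq₃, perpPlane, faceSign,
      complDir, dualSign, site_sub_sub_add_left]
  all_goals ring

/-! ### The dual configuration `ω• = (P₁•, P₂•)` -/

/-- `t_k ≠ 0` in a field. [cite: EldridgeForsstromSchweinhart2026, §4.4] -/
theorem dualSign_cast_ne_zero (k : Fin 3) : ((dualSign k : ℤ) : F) ≠ 0 := by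
  intro h0
  have h1 : ((dualSign k * dualSign k : ℤ) : F) = 1 := by rw [dualSign_mul_self, Int.cast_one]
  rw [Int.cast_mul, h0, zero_mul] at h1
  exact zero_ne_one h1

/-- **The dual configuration** (Definition 14 and Theorem 15): `ω• = (P₁•, P₂•)` — the dual
plaquettes of the CLOSED edges and the dual edges of the CLOSED plaquettes — again a CPP
configuration on `𝕋³_L` (the case `d = 3`, `i = 1 = d - i - 1`).
[cite: EldridgeForsstromSchweinhart2026, §1.2 Def. 14 and Thm. 15] -/
def dualConfig₃ (ω : CppConfig 3 L) : CppConfig 3 L :=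
  ((ω.2ᶜ).map ⟨dualPlaq₃, dualPlaq₃_injective⟩, (ω.1ᶜ).map ⟨dualEdge₃, dualEdge₃_injective⟩)

/-- `|P₁•| = |X¹| - |P₁|`. [cite: EldridgeForsstromSchweinhart2026, §4.4 (proof of Thm. 15: |P₂•| = |𝕋^{(i+1)}| - |P₂|)] -/
theorem card_dualConfig₃_fst (ω : CppConfig 3 L) : (dualConfig₃ ω).1.card = ω.2ᶜ.card :=
  Finset.card_map _

/-- `|P₂•| = |X²| - |P₂|`. [cite: EldridgeForsstromSchweinhart2026, §4.4 (proof of Thm. 15)] -/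
theorem card_dualConfig₃_snd (ω : CppConfig 3 L) : (dualConfig₃ ω).2.card = ω.1ᶜ.card :=
  Finset.card_map _

/-- `|(P₁•)ᶜ| = |P₁|`. [cite: EldridgeForsstromSchweinhart2026, §4.4 (proof of Thm. 15)] -/
theorem card_compl_dualConfig₃_fst (ω : CppConfig 3 L) : (dualConfig₃ ω).1ᶜ.card = ω.2.card := by
  rw [Finset.card_compl, card_dualConfig₃_fst, Finset.card_compl, card_plaquette_eq_card_edge]
  have := Finset.card_le_univ ω.2
  omega

/-- `|(P₂•)ᶜ| = |P₂|`. [cite: EldridgeForsstromSchweinhart2026, §4.4 (proof of Thm. 15)] -/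
theorem card_compl_dualConfig₃_snd (ω : CppConfig 3 L) : (dualConfig₃ ω).2ᶜ.card = ω.1.card := by
  rw [Finset.card_compl, card_dualConfig₃_snd, Finset.card_compl, ← card_plaquette_eq_card_edge]
  have := Finset.card_le_univ ω.1
  omega

/-- The open dual plaquettes are the duals of the closed edges. [cite: EldridgeForsstromSchweinhart2026, §1.2 Def. 14] -/
theorem mem_dualConfig₃_fst {ω : CppConfig 3 L} {τ : Plaquette 3 L} :
    τ ∈ (dualConfig₃ ω).1 ↔ ∃ e : Site 3 L × Fin 3, e ∉ ω.2 ∧ dualPlaq₃ e = τ := by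
  simp [dualConfig₃]

/-- The open dual edges are the duals of the closed plaquettes. [cite: EldridgeForsstromSchweinhart2026, §1.2 Def. 14] -/
theorem mem_dualConfig₃_snd {ω : CppConfig 3 L} {ε : Site 3 L × Fin 3} :
    ε ∈ (dualConfig₃ ω).2 ↔ ∃ σ : Plaquette 3 L, σ ∉ ω.1 ∧ dualEdge₃ σ = ε := by
  simp [dualConfig₃]

/-- `(x,k)• ∈ P₁• ↔ (x,k) ∉ P₁`. [cite: EldridgeForsstromSchweinhart2026, §1.2 Def. 14] -/
theorem dualPlaq₃_mem_dualConfig₃_fst {ω : CppConfig 3 L} {e : Site 3 L × Fin 3} :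
    dualPlaq₃ e ∈ (dualConfig₃ ω).1 ↔ e ∉ ω.2 := by
  rw [mem_dualConfig₃_fst]
  constructor
  · rintro ⟨e', he', h⟩
    rwa [← dualPlaq₃_injective h]
  · exact fun h => ⟨e, h, rfl⟩

/-- `σ• ∈ P₂• ↔ σ ∉ P₂`. [cite: EldridgeForsstromSchweinhart2026, §1.2 Def. 14] -/
theorem dualEdge₃_mem_dualConfig₃_snd {ω : CppConfig 3 L} {σ : Plaquette 3 L} :
    dualEdge₃ σ ∈ (dualConfig₃ ω).2 ↔ σ ∉ ω.1 := by
  rw [mem_dualConfig₃_snd]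
  constructor
  · rintro ⟨σ', hσ', h⟩
    rwa [← dualEdge₃_injective h]
  · exact fun h => ⟨σ, h, rfl⟩

/-- `ω ↦ ω•` is injective (hence a bijection of the finite set of configurations).
[cite: EldridgeForsstromSchweinhart2026, §1.2 Thm. 15 ("a bijective measure-preserving mapping")] -/
theorem dualConfig₃_injective : Function.Injective (dualConfig₃ (L := L)) := by
  intro ω ω' h
  have h1 := Finset.map_injective ⟨dualPlaq₃, dualPlaq₃_injective⟩ (congrArg Prod.fst h)
  have h2 := Finset.map_injective ⟨dualEdge₃, dualEdge₃_injective⟩ (congrArg Prod.snd h)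
  exact Prod.ext (compl_injective h2) (compl_injective h1)

/-- `ω ↦ ω•` is a bijection of `CppConfig 3 L`. [cite: EldridgeForsstromSchweinhart2026, §1.2 Thm. 15] -/
theorem dualConfig₃_bijective : Function.Bijective (dualConfig₃ (L := L)) :=
  (Finite.injective_iff_bijective).mp dualConfig₃_injective

/-! ### `H¹(P₁•, P₂•) ≅ H₂(P₂, P₁)` (Proposition 25 for `d = 3`, `i = 1`) and the Betti identity -/

/-- **Relative Alexander duality on `𝕋³`, concretely**: the dual `1`-cochain `g_c` is compatible
with `ω• = (P₁•, P₂•)` iff the `2`-chain `c` is a relative `2`-cycle of `(P₂, P₁)`.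
[cite: EldridgeForsstromSchweinhart2026, §4.4 Prop. 25] -/
theorem dualCochain₃_mem_relFlatCochains_iff (ω : CppConfig 3 L) (c : Plaquette 3 L → F) :
    dualCochain₃ c ∈ relFlatCochains F F (dualConfig₃ ω) ↔ c ∈ relTwoCycles F ω := by
  rw [mem_relFlatCochains, mem_relTwoCycles]
  constructor
  · rintro ⟨hflat, hvan⟩
    refine ⟨fun σ hσ => ?_, fun e he => ?_⟩
    · have h := hvan (dualEdge₃ σ) (dualEdge₃_mem_dualConfig₃_snd.mpr hσ)
      rw [dualCochain₃_dualEdge₃] at h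
      rcases mul_eq_zero.mp h with h | h
      · exact absurd h (faceSign_cast_ne_zero σ.2)
      · exact h
    · have h := hflat (dualPlaq₃ e) (dualPlaq₃_mem_dualConfig₃_fst.mpr he)
      obtain ⟨x, k⟩ := e
      rw [res_td₁_dualCochain₃_dualPlaq₃] at h
      rcases mul_eq_zero.mp h with h | h
      · exact absurd h (dualSign_cast_ne_zero k)
      · exact h
  · rintro ⟨hsupp, hbd⟩
    refine ⟨fun τ hτ => ?_, fun ε hε => ?_⟩
    · obtain ⟨⟨x, k⟩, he, rfl⟩ := mem_dualConfig₃_fst.mp hτ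
      rw [res_td₁_dualCochain₃_dualPlaq₃, hbd (x, k) he, mul_zero]
    · obtain ⟨σ, hσ, rfl⟩ := mem_dualConfig₃_snd.mp hε
      rw [dualCochain₃_dualEdge₃, hsupp σ hσ, mul_zero]

/-- `Z¹(P₁•, P₂•; F)` is the image of `Z₂(P₂, P₁; F)` under the transfer. [cite: EldridgeForsstromSchweinhart2026, §4.4 Prop. 25] -/
theorem relFlatCochains_dualConfig₃_eq (ω : CppConfig 3 L) :
    relFlatCochains F F (dualConfig₃ ω) =
      (relTwoCycles F ω).map (dualCochainEquiv₃ (L := L) (F := F)).toLinearMap := by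
  ext g
  rw [Submodule.mem_map]
  constructor
  · intro hg
    refine ⟨(dualCochainEquiv₃ (L := L) (F := F)).symm g, ?_, LinearEquiv.apply_symm_apply _ g⟩
    rw [← dualCochain₃_mem_relFlatCochains_iff, ← dualCochainEquiv₃_apply, LinearEquiv.apply_symm_apply]
    exact hg
  · rintro ⟨c, hc, rfl⟩
    exact (dualCochain₃_mem_relFlatCochains_iff ω c).mpr hc

/-- **Proposition 25 as a Betti identity**: `b₁(P₁•, P₂•) = dim Z₂(P₂, P₁) = b₂(P₂, P₁)`.
[cite: EldridgeForsstromSchweinhart2026, §4.4 Prop. 25] -/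
theorem relBettiOne_dualConfig₃ (ω : CppConfig 3 L) :
    relBettiOne F (dualConfig₃ ω) = finrank F (relTwoCycles F ω) := by
  unfold relBettiOne
  rw [relFlatCochains_dualConfig₃_eq, LinearEquiv.finrank_map_eq]

/-- **`b₁(ω•) + |X¹| = b₁(ω) + |P₂| + |P₁|`** (Prop. 25 with Lemma 26): the exponent bookkeeping of
Theorem 15. [cite: EldridgeForsstromSchweinhart2026, §4.4 (proof of Thm. 15, first display)] -/
theorem relBettiOne_dualConfig₃_add (ω : CppConfig 3 L) :
    relBettiOne F (dualConfig₃ ω) + Fintype.card (Site 3 L × Fin 3) =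
      relBettiOne F ω + ω.1.card + ω.2.card := by
  rw [relBettiOne_dualConfig₃]
  exact finrank_relTwoCycles_add F ω

/-! ### Theorem 15: the weights and the probabilities -/

/-- For `p ∈ (0,1)` and `q > 0` the dual parameter `p• = q(1-p)/(p + q(1-p))` of Theorem 15 — the
tree's `PlaquetteRC.dualParam p q` (`k• = q/k` for the odds `k = p/(1-p)`; the plaquette parameter of
`ω•` is `(p₁)•`, its edge parameter `(p₂)•`) — lies in `(0,1)`.
[cite: EldridgeForsstromSchweinhart2026, §1.2 Thm. 15] -/
theorem dualParam_mem_Ioo {q : ℝ} (hq : 0 < q) {p : ℝ} (hp : p ∈ Set.Ioo (0 : ℝ) 1) :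
    dualParam p q ∈ Set.Ioo (0 : ℝ) 1 := by
  have h1 : 0 < 1 - p := sub_pos.mpr hp.2
  have hden : 0 < (1 - p) * q + p := by nlinarith [hp.1]
  unfold dualParam
  constructor
  · exact div_pos (by nlinarith) hden
  · rw [div_lt_one hden]; linarith [hp.1]

/-- The key scalar identity behind Theorem 15: `(1 - p•) · q · (1 - p) = p• · p` (i.e. `k• k = q`).
[cite: EldridgeForsstromSchweinhart2026, §4.4 (proof of Thm. 15: k₂' = q/k₁, k₁' = q/k₂)] -/
theorem one_sub_dualParam_mul {q : ℝ} (hq : 0 < q) {p : ℝ} (hp : p ∈ Set.Ioo (0 : ℝ) 1) :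
    (1 - dualParam p q) * q * (1 - p) = dualParam p q * p := by
  have h1 : 0 < 1 - p := sub_pos.mpr hp.2
  have hden : (1 - p) * q + p ≠ 0 := by nlinarith [hp.1]
  unfold dualParam
  field_simp
  ring

variable (q : ℕ) [Fact q.Prime]

/-- **Theorem 15 (Eldridge–Forsström–Schweinhart), `d = 3`, `i = 1`, at the level of WEIGHTS**:
`ρ-weight_{p₁•, p₂•}(ω•) · (q(1-p₂)(1-p₁))^{|X¹|} = (p₁• p₂•)^{|X¹|} · ρ-weight_{p₂,p₁}(ω)` — the CPP
weight of the dual configuration at the dual parameters is a constant multiple of the CPP weight.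
Proof as printed: `|H¹(P₁•,P₂•)| = |H¹(P₂,P₁)| q^{|P₂|+|P₁|-|X¹|}` (Prop. 25 + Lemma 26) and the
choice `k₂' = q/k₁`, `k₁' = q/k₂`. [cite: EldridgeForsstromSchweinhart2026, §1.2 Thm. 15 and §4.4 (proof)] -/
theorem cppWeight_dualConfig₃ {p₂ p₁ : ℝ} (hp₂ : p₂ ∈ Set.Ioo (0 : ℝ) 1) (hp₁ : p₁ ∈ Set.Ioo (0 : ℝ) 1)
    (ω : CppConfig 3 L) :
    cppWeight (ZMod q) (dualParam p₁ q) (dualParam p₂ q) (dualConfig₃ ω) *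
        ((q : ℝ) * (1 - p₂) * (1 - p₁)) ^ Fintype.card (Site 3 L × Fin 3) =
      (dualParam p₁ q * dualParam p₂ q) ^ Fintype.card (Site 3 L × Fin 3) *
        cppWeight (ZMod q) p₂ p₁ ω := by
  have hq0 : (0 : ℝ) < q := by exact_mod_cast (Fact.out : q.Prime).pos
  have key2 := one_sub_dualParam_mul hq0 hp₁
  have key1 := one_sub_dualParam_mul hq0 hp₂
  -- cell counts and the Betti identity `b₁(ω•) + |X¹| = b₁(ω) + |P₂| + |P₁|`
  have hN1 : ω.1.card + ω.1ᶜ.card = Fintype.card (Site 3 L × Fin 3) := by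
    rw [Finset.card_add_card_compl, card_plaquette_eq_card_edge]
  have hN2 : ω.2.card + ω.2ᶜ.card = Fintype.card (Site 3 L × Fin 3) := Finset.card_add_card_compl _
  have hB := relBettiOne_dualConfig₃_add (F := ZMod q) ω
  unfold cppWeight
  rw [relCocycleCard_zmod_eq q, relCocycleCard_zmod_eq q, card_dualConfig₃_fst, card_dualConfig₃_snd,
    card_compl_dualConfig₃_fst, card_compl_dualConfig₃_snd]
  push_cast
  generalize dualParam p₁ (q : ℝ) = p₂' at key2 ⊢
  generalize dualParam p₂ (q : ℝ) = p₁' at key1 ⊢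
  generalize Fintype.card (Site 3 L × Fin 3) = N at hN1 hN2 hB ⊢
  subst hN1
  have hB2 : relBettiOne (ZMod q) (dualConfig₃ ω) + ω.1ᶜ.card = relBettiOne (ZMod q) ω + ω.2.card := by
    omega
  -- the three substitutions of the printed proof, as power identities
  have hq : (q : ℝ) ^ relBettiOne (ZMod q) (dualConfig₃ ω) * (q : ℝ) ^ ω.1ᶜ.card =
      (q : ℝ) ^ relBettiOne (ZMod q) ω * (q : ℝ) ^ ω.2.card := by rw [← pow_add, hB2, pow_add]
  have e2 : (1 - p₁) ^ (ω.1.card + ω.1ᶜ.card) = (1 - p₁) ^ ω.2.card * (1 - p₁) ^ ω.2ᶜ.card := by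
    rw [← hN2, pow_add]
  have e3 : p₂' ^ (ω.1.card + ω.1ᶜ.card) = p₂' ^ ω.2.card * p₂' ^ ω.2ᶜ.card := by
    rw [← hN2, pow_add]
  have k2 := congrArg (fun t : ℝ => t ^ ω.2.card) key2
  have k1 := congrArg (fun t : ℝ => t ^ ω.1.card) key1
  simp only [mul_pow] at k1 k2
  simp only [mul_pow]
  rw [e2, e3]
  linear_combination
    (p₂' ^ ω.2ᶜ.card * (1 - p₂') ^ ω.2.card * p₁' ^ ω.1ᶜ.card * (1 - p₁') ^ ω.1.card *
        (q : ℝ) ^ ω.1.card * (1 - p₂) ^ ω.1.card * (1 - p₂) ^ ω.1ᶜ.card * (1 - p₁) ^ ω.2.card *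
        (1 - p₁) ^ ω.2ᶜ.card) * hq +
    (p₂' ^ ω.2ᶜ.card * p₁' ^ ω.1ᶜ.card * (q : ℝ) ^ relBettiOne (ZMod q) ω * (1 - p₂) ^ ω.1ᶜ.card *
        (1 - p₁) ^ ω.2ᶜ.card * (1 - p₁') ^ ω.1.card * (q : ℝ) ^ ω.1.card * (1 - p₂) ^ ω.1.card) * k2 +
    (p₂' ^ ω.2ᶜ.card * p₁' ^ ω.1ᶜ.card * (q : ℝ) ^ relBettiOne (ZMod q) ω * (1 - p₂) ^ ω.1ᶜ.card *
        (1 - p₁) ^ ω.2ᶜ.card * p₂' ^ ω.2.card * p₁ ^ ω.2.card) * k1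

/-- The constant of Theorem 15 is positive. [cite: EldridgeForsstromSchweinhart2026, §1.2 Thm. 15] -/
theorem dualConst_pos {p₂ p₁ : ℝ} (hp₂ : p₂ ∈ Set.Ioo (0 : ℝ) 1) (hp₁ : p₁ ∈ Set.Ioo (0 : ℝ) 1) :
    0 < (dualParam p₁ q * dualParam p₂ q) ^ Fintype.card (Site 3 L × Fin 3) /
      ((q : ℝ) * (1 - p₂) * (1 - p₁)) ^ Fintype.card (Site 3 L × Fin 3) := by
  have hq0 : (0 : ℝ) < q := by exact_mod_cast (Fact.out : q.Prime).pos
  have h₂ := (dualParam_mem_Ioo hq0 hp₁).1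
  have h₁ := (dualParam_mem_Ioo hq0 hp₂).1
  have h₂' : 0 < 1 - p₂ := sub_pos.mpr hp₂.2
  have h₁' : 0 < 1 - p₁ := sub_pos.mpr hp₁.2
  positivity

/-- **Theorem 15 at the level of the normalising constants**: `Z• = C · Z` with the constant of
`cppWeight_dualConfig₃` (the map `ω ↦ ω•` is a bijection).
[cite: EldridgeForsstromSchweinhart2026, §1.2 Thm. 15 and §4.4 (proof)] -/
theorem cppPartitionFn_dual₃ {p₂ p₁ : ℝ} (hp₂ : p₂ ∈ Set.Ioo (0 : ℝ) 1) (hp₁ : p₁ ∈ Set.Ioo (0 : ℝ) 1) :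
    cppPartitionFn (d := 3) (L := L) (ZMod q) (dualParam p₁ q) (dualParam p₂ q) =
      (dualParam p₁ q * dualParam p₂ q) ^ Fintype.card (Site 3 L × Fin 3) /
          ((q : ℝ) * (1 - p₂) * (1 - p₁)) ^ Fintype.card (Site 3 L × Fin 3) *
        cppPartitionFn (d := 3) (L := L) (ZMod q) p₂ p₁ := by
  have hq0 : (0 : ℝ) < q := by exact_mod_cast (Fact.out : q.Prime).pos
  have hK : ((q : ℝ) * (1 - p₂) * (1 - p₁)) ^ Fintype.card (Site 3 L × Fin 3) ≠ 0 := by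
    have h₂' : 0 < 1 - p₂ := sub_pos.mpr hp₂.2
    have h₁' : 0 < 1 - p₁ := sub_pos.mpr hp₁.2
    positivity
  unfold cppPartitionFn
  rw [Finset.mul_sum, ← Fintype.sum_bijective _ dualConfig₃_bijective
    (fun ω => cppWeight (ZMod q) (dualParam p₁ q) (dualParam p₂ q) (dualConfig₃ ω)) _ fun _ => rfl]
  refine Finset.sum_congr rfl fun ω _ => ?_
  rw [div_mul_eq_mul_div, eq_div_iff hK]
  exact cppWeight_dualConfig₃ q hp₂ hp₁ ω

/-- **Theorem 15 (Eldridge–Forsström–Schweinhart: duality of coupled plaquette percolation)**, the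
self-dual case `X = 𝕋³_L`, `i = 1 = d - i - 1`, `q` prime, `p₁, p₂ ∈ (0,1)`:
`ρ_{𝕋³,q,p₂•,p₁•,1}(ω•) = ρ_{𝕋³,q,p₂,p₁,1}(ω)` with `p₂• = q(1-p₁)/(p₁+q(1-p₁))` and
`p₁• = q(1-p₂)/(p₂+q(1-p₂))`, where `ω ↦ ω•` (`dualConfig₃`) is a bijection.
[cite: EldridgeForsstromSchweinhart2026, §1.2 Thm. 15] -/
theorem cppProb_dualConfig₃ {p₂ p₁ : ℝ} (hp₂ : p₂ ∈ Set.Ioo (0 : ℝ) 1) (hp₁ : p₁ ∈ Set.Ioo (0 : ℝ) 1)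
    (ω : CppConfig 3 L) :
    cppProb (ZMod q) (dualParam p₁ q) (dualParam p₂ q) (dualConfig₃ ω) = cppProb (ZMod q) p₂ p₁ ω := by
  have hq0 : (0 : ℝ) < q := by exact_mod_cast (Fact.out : q.Prime).pos
  have hK : ((q : ℝ) * (1 - p₂) * (1 - p₁)) ^ Fintype.card (Site 3 L × Fin 3) ≠ 0 := by
    have h₂' : 0 < 1 - p₂ := sub_pos.mpr hp₂.2
    have h₁' : 0 < 1 - p₁ := sub_pos.mpr hp₁.2
    positivity
  have hw : cppWeight (ZMod q) (dualParam p₁ q) (dualParam p₂ q) (dualConfig₃ ω) =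
      (dualParam p₁ q * dualParam p₂ q) ^ Fintype.card (Site 3 L × Fin 3) /
          ((q : ℝ) * (1 - p₂) * (1 - p₁)) ^ Fintype.card (Site 3 L × Fin 3) *
        cppWeight (ZMod q) p₂ p₁ ω := by
    rw [div_mul_eq_mul_div, eq_div_iff hK]
    exact cppWeight_dualConfig₃ q hp₂ hp₁ ω
  unfold cppProb
  rw [hw, cppPartitionFn_dual₃ q hp₂ hp₁, mul_div_mul_left _ _ (dualConst_pos q hp₂ hp₁).ne']

open Classical in
/-- **Theorem 15, event form** ("a bijective measure-preserving mapping"): for every event `E`,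
`ρ_{p₂,p₁}(E) = ρ_{p₂•,p₁•}(E•)` with `E• = {ω• : ω ∈ E}`.
[cite: EldridgeForsstromSchweinhart2026, §1.2 Thm. 15] -/
theorem cppEventProb_image_dualConfig₃ {p₂ p₁ : ℝ} (hp₂ : p₂ ∈ Set.Ioo (0 : ℝ) 1)
    (hp₁ : p₁ ∈ Set.Ioo (0 : ℝ) 1) (E : Set (CppConfig 3 L)) :
    cppEventProb (ZMod q) (dualParam p₁ q) (dualParam p₂ q) (dualConfig₃ '' E) =
      cppEventProb (ZMod q) p₂ p₁ E := by
  unfold cppEventProb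
  rw [← Fintype.sum_bijective _ dualConfig₃_bijective
    (fun ω => if dualConfig₃ ω ∈ dualConfig₃ '' E then
      cppProb (ZMod q) (dualParam p₁ q) (dualParam p₂ q) (dualConfig₃ ω) else 0) _ fun _ => rfl]
  refine Finset.sum_congr rfl fun ω _ => ?_
  rw [dualConfig₃_injective.mem_set_image, cppProb_dualConfig₃ q hp₂ hp₁]

end CppDual3



end PlaquetteRC

end Literature.MathematicalPhysics.QuantumFieldTheory
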